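import Literature.NumberTheory.EllipticCurves.KatoRankBoundSelmerProofs
import Literature.NumberTheory.EllipticCurves.SelmerCorankControlProofs

/-!
# BirchSwinnertonDyer / PAdicOrderV2 — crux `PAdicOrderPadicBSDrankR2` (stmt-0490), line `Sketch`:
# the open residue `stub_padicBSDrank_noExcessHigh` reduced to Greenberg's Conjecture 1.12 at `T`
# (helper, `--supports`; does NOT close the stub)

The registered stub `stub_padicBSDrank_noExcessHigh` of `Cruxes/PAdicOrderPadicBSDrankR2/Lines/Sketch.lean`
asks, for `E/ℚ` (globally minimal `W`), an odd good ordinary prime `p` and the newform `f` of `E`,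
that `ord_{T=0} L_p(E,T) ≤ corank_{ℤ_p} Sel_{p^∞}(E/ℚ)` as soon as `ord_{T=0} L_p(E,T) ≥ 2` ("no
excess zeros"). Kato's theorem is the reverse inequality. This file kernel-checks what the
residue consists of, in the tree's vocabulary:

* `order_iwasawaToPowerSeries`: `ι : Λ = ℤ_p⟦T⟧ ↪ ℚ_p⟦T⟧` preserves `ord_{T=0}`.
* `noExcess_order_eq_selmerCorank_of_data`: at one point `(E, p, f)`, given the cyclotomic
  Iwasawa module `X = X(E/ℚ_∞)` (`D : SelmerDualData`, f.g. torsion), the MAIN-CONJECTURE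
  EQUALITY in `Λ ⊗ ℚ_p` (`char_Λ X = (g)`, `ι g = p^k L_p(E,T)`, the shape of clause 2 of
  `skinner_urban_main_conjecture`), SEMISIMPLICITY of `T` on `ℚ_p ⊗ X` at `T = 0`
  (`ker T² = ker T`, Greenberg LNM 1716 Conj. 1.12 in the spelling of the tree fact
  `Greenberg1999_order_charGenerator_eq_coinvariantsRank`, PROVED in `SelmerCorankControlProofs`)
  and the CONTROL identity `rank_{ℤ_p} X/TX = corank Sel_{p^∞}(E/ℚ)` (Mazur; tree fact
  `Greenberg1999_coinvariantsRank_eq_selmerCorank_rat`), one has the EQUALITY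
  `ord_{T=0} L_p(E,T) = corank_{ℤ_p} Sel_{p^∞}(E/ℚ)` — hence no excess zeros.
* `noExcess_order_eq_selmerCorank_of_skinnerUrban`: the universally quantified form on the
  Skinner–Urban locus (`p ≥ 3` good ordinary, `ρ̄_{E,p}` irreducible, a multiplicative prime
  `ℓ ≠ p` with `p ∤ v_ℓ(Δ)`), from the three named facts `skinner_urban_main_conjecture`
  (Skinner–Urban 2014 Thm 3.6.9), Greenberg's Conj. 1.12 at `T` (OPEN; = the parked item
  stmt-BirchSwinnertonDyer-14959 up to the spelling `ℚ_p ⊗ X` vs. `p`-power torsion) and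
  `Greenberg1999_coinvariantsRank_eq_selmerCorank_rat`; the cyclotomic setting, the existence and
  the finite generation of `X(E/ℚ_∞)` are tree theorems
  (`exists_isCyclotomic_isTopGenerator_isCyclotomicVariable_holds`, `nonempty_selmerDualData_holds`,
  `finite_selmerInfty_pTorsion_invariants_holds` + Nakayama).
* `noExcessHigh_of_skinnerUrban`: the stub's own conclusion `2 ≤ ord → ord ≤ corank` on that locus.

What is NOT covered (= what keeps the stub open beyond Conj. 1.12): `(E,p)` off the Skinner–Urban
locus — `ρ̄_{E,p}` reducible (Greenberg–Vatsal IMC), CM curves (Rubin), no ramified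
multiplicative prime — where no main-conjecture equality is vendored in the tree.
-/

-- D-0017: single-problem summit, so `Summit.BirchSwinnertonDyer.BirchSwinnertonDyer.…` repeats a
-- namespace BY DESIGN.
set_option linter.dupNamespace false

noncomputable section

namespace Summit.BirchSwinnertonDyer.BirchSwinnertonDyer.Theorems

open scoped MatrixGroups ModularForm
open CongruenceSubgroup Literature.NumberTheory.EllipticCurves
  Literature.NumberTheory.EllipticCurves.ModularForms
  Literature.NumberTheory.EllipticCurves.IwasawaAlgebra

universe u

/-- **`ι : ℤ_p⟦T⟧ ↪ ℚ_p⟦T⟧` preserves the order of vanishing at `T = 0`**: the coefficients are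
mapped by the injection `ℤ_p ↪ ℚ_p`, so the first non-zero one stays the first non-zero one
(Mazur–Tate–Teitelbaum 1986, §I.12: `Λ ⊗ ℚ_p ⊂ ℚ_p⟦T⟧`). [folklore] -/
theorem order_iwasawaToPowerSeries (p : ℕ) [Fact p.Prime] (g : IwasawaAlgebra p) :
    (iwasawaToPowerSeries p g).order = g.order := by
  refine le_antisymm ?_ (PowerSeries.le_order_map _)
  refine PowerSeries.le_order _ _ (fun i hi ↦ ?_)
  have h0 : PowerSeries.coeff i (iwasawaToPowerSeries p g) = 0 := PowerSeries.coeff_of_lt_order i hi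
  rw [PowerSeries.coeff_map] at h0
  exact (map_eq_zero_iff (algebraMap ℤ_[p] ℚ_[p])
    (FaithfulSMul.algebraMap_injective ℤ_[p] ℚ_[p])).mp h0

/-- **No excess zeros from main conjecture + semisimplicity + control, at one point.** Let `E/ℚ`
(globally minimal `W`) be good ordinary at `p`, `f` its newform, `κ` a cyclotomic `ℤ_p`-extension of
`ℚ` with topological generator `γ`, `D` Pontryagin-dual data for `Sel_{p^∞}(E/ℚ_∞)` with
`X = D.X` finitely generated and `Λ`-torsion. Assume
(IMC) `char_Λ X = (g)` and `ι g = p^k · L_p(E,T)` for some `g ∈ Λ`, `k ∈ ℤ` (main-conjecture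
equality in `Λ ⊗ ℚ_p`, clause 2 of `skinner_urban_main_conjecture`);
(SS) `ker T² = ker T` on `ℚ_p ⊗_{ℤ_p} X` (Greenberg, LNM 1716, Conj. 1.12 at `T`);
(CTL) `rank_{ℤ_p} X/TX = corank_{ℤ_p} Sel_{p^∞}(E/ℚ)` (Mazur's control theorem).
Then `ord_{T=0} L_p(E,T) = corank_{ℤ_p} Sel_{p^∞}(E/ℚ)`: indeed
`ord L_p = ord (p^k L_p) = ord (ι g) = ord g` (`order_iwasawaToPowerSeries`) `= rank X/TX`
(tree theorem `Greenberg1999_order_charGenerator_eq_coinvariantsRank_holds`, Washington §13.2)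
`= corank Sel`. Greenberg (1999), §1 p. 65: "`rank_{ℤ_p}(X/TX)` … would equal the power of `T`
dividing `f_E(T)`, assuming [Conj. 1.12]". [cite: GreenbergLNM1716, §1 Conj. 1.12 and p. 65] -/
theorem noExcess_order_eq_selmerCorank_of_data
    (W : WeierstrassCurve ℚ) [W.IsElliptic] [W.IsGloballyMinimal] (p : ℕ) [Fact p.Prime]
    {N : ℕ} [NeZero N] (f : CuspForm (Gamma0 N) 2)
    {κ : ZpExtension ℚ p} {γ : Field.absoluteGaloisGroup ℚ}
    (D : W.SelmerDualData κ γ) [Module.Finite (IwasawaAlgebra p) D.X] (hX : D.IsTorsion)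
    (hIMC : ∃ (g : IwasawaAlgebra p) (k : ℤ), D.charIdeal = Ideal.span {g} ∧
      iwasawaToPowerSeries p g =
        PowerSeries.C ((p : ℚ_[p]) ^ k) * padicLFunction f (unitRoot W p : ℚ_[p]))
    (hSS : LinearMap.ker (mulTRat p D.X ∘ₗ mulTRat p D.X) = LinearMap.ker (mulTRat p D.X))
    (hCTL : coinvariantsRank p D.X = W.selmerCorank p) :
    (padicLFunction f (unitRoot W p : ℚ_[p])).order = W.selmerCorank p := by
  obtain ⟨g, k, hg, hιg⟩ := hIMC
  -- `ord g = rank X/TX` (structure theorem + semisimplicity), `= corank Sel` (control)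
  have h1 : g.order = (coinvariantsRank p D.X : ℕ∞) :=
    Greenberg1999_order_charGenerator_eq_coinvariantsRank_holds p D.X hX g hg hSS
  -- `ord (ι g) = ord (p^k L_p) = ord L_p`
  have hpk : IsUnit (PowerSeries.C ((p : ℚ_[p]) ^ k)) := by
    refine IsUnit.map PowerSeries.C (IsUnit.mk0 _ (zpow_ne_zero k ?_))
    exact_mod_cast (Fact.out : p.Prime).ne_zero
  have h2 : (iwasawaToPowerSeries p g).order =
      (padicLFunction f (unitRoot W p : ℚ_[p])).order := by
    rw [hιg, PowerSeries.order_mul, PowerSeries.order_zero_of_unit hpk, zero_add]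
  rw [← h2, order_iwasawaToPowerSeries, h1, hCTL]

/-- **No excess zeros on the Skinner–Urban locus, from three named facts.** Assume
(IMC) `skinner_urban_main_conjecture` at every cyclotomic datum (Skinner–Urban 2014, Thm 3.6.9:
`char_Λ X(E/ℚ_∞) = (L_p(E,T))` in `Λ ⊗ ℚ_p` for `p ≥ 3` good ordinary, `ρ̄_{E,p}` irreducible and a
multiplicative prime `ℓ ≠ p` at which `ρ̄_{E,p}` is ramified);
(SS) Greenberg's Conjecture 1.12 at `T` for `X(E/ℚ_∞)` at odd good ordinary `p`: `ker T² = ker T`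
on `ℚ_p ⊗_{ℤ_p} X` (OPEN; the Selmer-side semisimplicity item of the route's tenure split);
(CTL) Mazur's control theorem in corank form, `Greenberg1999_coinvariantsRank_eq_selmerCorank_rat`.
Then for every `E/ℚ` (globally minimal `W`) and every `p ≥ 3` of good ordinary reduction on that
locus, and the newform `f` of `E`: `ord_{T=0} L_p(E,T) = corank_{ℤ_p} Sel_{p^∞}(E/ℚ)`. The
cyclotomic setting and the Iwasawa module with its finite generation are tree theorems
(`exists_isCyclotomic_isTopGenerator_isCyclotomicVariable_holds`, `nonempty_selmerDualData_holds`,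
`finite_selmerInfty_pTorsion_invariants_holds`, `module_finite_of_finite_pTorsion_invariants`);
torsion-ness of `X` is clause 1 of (IMC). [cite: SkinnerUrban2014, Thm. 3.6.9 (p. 45)]
[cite: GreenbergLNM1716, §1 Conj. 1.12, Thm. 1.2 and p. 65] -/
theorem noExcess_order_eq_selmerCorank_of_skinnerUrban
    (hIMC : ∀ (W : WeierstrassCurve ℚ) [W.IsElliptic] [W.IsGloballyMinimal] (p : ℕ) [Fact p.Prime]
      (κ : ZpExtension ℚ p) (γ : Field.absoluteGaloisGroup ℚ) (N : ℕ) [NeZero N]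
      (f : CuspForm (Gamma0 N) 2), skinner_urban_main_conjecture W p (κ := κ) (γ := γ) (f := f))
    (hSS : ∀ (W : WeierstrassCurve ℚ) [W.IsElliptic] [W.IsGloballyMinimal] (p : ℕ) [Fact p.Prime],
      p ≠ 2 → W.HasGoodReductionAtPrime p → ¬ (p : ℤ) ∣ W.frobeniusTrace p →
      ∀ (κ : ZpExtension ℚ p) (γ : Field.absoluteGaloisGroup ℚ), κ.IsCyclotomic →
      κ.IsTopGenerator γ → ∀ (D : W.SelmerDualData κ γ),
      LinearMap.ker (mulTRat p D.X ∘ₗ mulTRat p D.X) = LinearMap.ker (mulTRat p D.X))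
    (hCTL : Greenberg1999_coinvariantsRank_eq_selmerCorank_rat) :
    ∀ (W : WeierstrassCurve ℚ) [W.IsElliptic] [W.IsGloballyMinimal] (p : ℕ) [Fact p.Prime],
      3 ≤ p → IsOrdinaryAt W p → W.HasIrreducibleModPGaloisRep p →
      (∃ ℓ : ℕ, ∃ _ : Fact ℓ.Prime, ℓ ≠ p ∧ W.HasMultiplicativeReductionAtPrime ℓ ∧
        ¬ p ∣ padicValInt ℓ W.minimalDiscriminantInt) →
      ∀ {N : ℕ} [NeZero N] (f : CuspForm (Gamma0 N) 2), IsNewformOf W f →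
      (padicLFunction f (unitRoot W p : ℚ_[p])).order = W.selmerCorank p := by
  intro W _ _ p _ hp3 hord hirr haux N _ f hf
  have hp2 : p ≠ 2 := by omega
  obtain ⟨κ, hκ, γ, hγ, hγ'⟩ := exists_isCyclotomic_isTopGenerator_isCyclotomicVariable_holds p
  obtain ⟨D⟩ := W.nonempty_selmerDualData_holds κ γ hγ
  haveI : Module.Finite (IwasawaAlgebra p) D.X :=
    D.module_finite_of_finite_pTorsion_invariants W
      (W.finite_selmerInfty_pTorsion_invariants_holds κ γ) hκ hγ
  obtain ⟨hX, hmc, -⟩ := hIMC W p κ γ N f hp3 hord.1 hord.2 hirr haux hκ hγ hγ' hf D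
  exact noExcess_order_eq_selmerCorank_of_data W p f D hX hmc
    (hSS W p hp2 hord.1 hord.2 κ γ hκ hγ D) (hCTL W p hord.1 hord.2 κ γ hκ hγ D).2

/-- **The registered stub's conclusion on the Skinner–Urban locus.** Under the three named facts
of `noExcess_order_eq_selmerCorank_of_skinnerUrban` (IMC of Skinner–Urban, Greenberg's Conj. 1.12
at `T`, Mazur control), for `p ≥ 3` good ordinary with `ρ̄_{E,p}` irreducible and a ramified
multiplicative prime: `2 ≤ ord_{T=0} L_p(E,T) → ord_{T=0} L_p(E,T) ≤ corank_{ℤ_p} Sel_{p^∞}(E/ℚ)`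
— the shape of `stub_padicBSDrank_noExcessHigh` (whose remaining content is thus Conj. 1.12 on
this locus, and a main-conjecture equality off it). [cite: GreenbergLNM1716, §1 Conj. 1.12 and p. 65] -/
theorem noExcessHigh_of_skinnerUrban :
    (∀ (W : WeierstrassCurve ℚ) [W.IsElliptic] [W.IsGloballyMinimal] (p : ℕ) [Fact p.Prime] (κ :
    Literature.NumberTheory.EllipticCurves.ZpExtension ℚ p) (γ : Field.absoluteGaloisGroup ℚ) (N :
    ℕ) [NeZero N] (f : CuspForm (CongruenceSubgroup.Gamma0 N) 2),
    Literature.NumberTheory.EllipticCurves.skinner_urban_main_conjecture W p (κ := κ) (γ := γ) (f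
    := f)) → (∀ (W : WeierstrassCurve ℚ) [W.IsElliptic] [W.IsGloballyMinimal] (p : ℕ) [Fact
    p.Prime], p ≠ 2 → W.HasGoodReductionAtPrime p → ¬ (p : ℤ) ∣ W.frobeniusTrace p → ∀ (κ :
    Literature.NumberTheory.EllipticCurves.ZpExtension ℚ p) (γ : Field.absoluteGaloisGroup ℚ),
    κ.IsCyclotomic → κ.IsTopGenerator γ → ∀ (D : W.SelmerDualData κ γ), LinearMap.ker
    (Literature.NumberTheory.EllipticCurves.IwasawaAlgebra.mulTRat p D.X ∘ₗ
    Literature.NumberTheory.EllipticCurves.IwasawaAlgebra.mulTRat p D.X) = LinearMap.ker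
    (Literature.NumberTheory.EllipticCurves.IwasawaAlgebra.mulTRat p D.X)) →
    Literature.NumberTheory.EllipticCurves.Greenberg1999_coinvariantsRank_eq_selmerCorank_rat → ∀
    (W : WeierstrassCurve ℚ) [W.IsElliptic] [W.IsGloballyMinimal] (p : ℕ) [Fact p.Prime], 3 ≤ p →
    Literature.NumberTheory.EllipticCurves.IsOrdinaryAt W p → W.HasIrreducibleModPGaloisRep p → (∃
    ℓ : ℕ, ∃ _ : Fact ℓ.Prime, ℓ ≠ p ∧ W.HasMultiplicativeReductionAtPrime ℓ ∧ ¬ p ∣ padicValInt ℓ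
    W.minimalDiscriminantInt) → ∀ {N : ℕ} [NeZero N] (f : CuspForm (CongruenceSubgroup.Gamma0 N)
    2), Literature.NumberTheory.EllipticCurves.ModularForms.IsNewformOf W f → 2 ≤
    (Literature.NumberTheory.EllipticCurves.padicLFunction f
    (Literature.NumberTheory.EllipticCurves.unitRoot W p : ℚ_[p])).order →
    (Literature.NumberTheory.EllipticCurves.padicLFunction f
    (Literature.NumberTheory.EllipticCurves.unitRoot W p : ℚ_[p])).order ≤ W.selmerCorank p := by
  intro hIMC hSS hCTL W _ _ p _ hp3 hord hirr haux N _ f hf _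
  exact (noExcess_order_eq_selmerCorank_of_skinnerUrban hIMC hSS hCTL W p hp3 hord hirr haux f hf).le

end Summit.BirchSwinnertonDyer.BirchSwinnertonDyer.Theorems

end
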